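import Summits.KontsevichZagierPeriods.KontsevichZagierPeriods.Theorems.LinRedNormalFormArrangementNormalFormStubRebaseSimpleZeroNestedBlowUpChart
import Summits.KontsevichZagierPeriods.KontsevichZagierPeriods.Theorems.LinRedNormalFormArrangementNormalFormStubRebaseSimpleZeroNestedCone
import Summits.KontsevichZagierPeriods.KontsevichZagierPeriods.Theorems.LinRedNormalFormArrangementNormalFormStubRebaseSimpleZeroProductBlow
import Summits.KontsevichZagierPeriods.KontsevichZagierPeriods.Theorems.LinRedNormalFormArrangementNormalFormStubRebaseSimplePosOneFibreBlow

/-!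
# Stub `stub_rebaseSimpleZeroTwo`, part `rebaseSimpleZero_nestedBlowUp` (crux `ArrangementNormalForm`,
line `janus-bands`, v6.2) — brick `NestedBlowUpMove`

The PINCH-VERTEX BLOW-UP of a clean nested pair `A < tᵢ < tⱼ < B` over the one-dimensional
base cell `{0 < ε₁ (y − y₀) < δ}` (drefute g3, §5), in the normal form "polar fibre = inner
fibre": the bounds pass through the pinch vertex `(y₀, t₀)` (`A = t₀ + α (y − y₀)`,
`B = t₀ + β (y − y₀)`, slopes `α, β` weakly on one side `σ` of `0`), the simple base pole sits AT
`y₀`, the inner fibre carries the pole `tᵢ = t₀` through the vertex and the outer letter is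
`y`-free (or absent). ONE rational change of variables (rule 2), the chart
`RebaseNest.bmap ε y₀ t₀ j` with `ε = σ ε₁` — `y − y₀ = ε Z/b`, `tᵢ − t₀ = ε a Z/b`,
`tⱼ − t₀ = ε Z`, Jacobian `Z²/|b|³` — pulls the representation back (`RebaseZero.cov_pull`) to the
literal PRODUCT datum over the new base `b` (the radial slope of the outer fibre):
rows `ε₁ α < ε₁ b < ε₁ β`, polar fibre `a` between `α` and `b`, radial fibre `0 < Z < δ σ b`,
integrand `± c/(b · a · (Z − μ'))` (`RebaseNest.blowNest_pull`); one per-fibre affine pull-back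
(`RebasePos.good_product`) then lands in `GG 0 2 2` (`RebaseNest.blowNest_inner`, registered as
`rebaseSimpleZero_nestedBlowUpInner`). Unit test: drefute g3's member
`N₂ = [{1<y<2, y<t₁<t₂<3y−2}, 1/((y−1)(t₁−1)(t₂−5))] ↦ [{1<a<b<3, 0<Z<b}, 1/(a b (Z−4))]`.

References: M. Kontsevich, D. Zagier, *Periods* (2001), §1.2, rule (2).
-/

noncomputable section

open Set MeasureTheory MvPolynomial
open Literature.NumberTheory.Transcendental Literature.ModelTheory.ExponentialFields

namespace Summit.KontsevichZagierPeriods.ArrangementNormalForm.JanusBands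

namespace RebaseNest

open SeparatePos RebasePos

section Algebra

/-- A one-dimensional-base affine form with constant slope vector. [folklore] -/
theorem affF_slope (q r : ℚ) (z : Fin (0 + 1 + 2) → ℝ) :
    affF 0 2 ((fun _ => q), r) z = q * z 0 + r := by
  simp [affF]

/-- The literal letter sum of a `y`-free letter is its constant. [folklore] -/
theorem letter_sum {c : (Fin (0 + 1) → ℚ) × ℚ} (hc : c.1 (Fin.last 0) = 0) (z : Fin (0 + 1 + 2) → ℝ) :
    (∑ i', (c.1 i' : ℝ) * z (Fin.castAdd 2 i') + (c.2 : ℝ)) = c.2 := by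
  rw [RebaseZero.sum_eq, RebaseZero.ev, hc]
  simp

/-- `|x| ≤ |p| + |q|` when `x` lies between `p` and `q` in the `ε₁`-order (`ε₁ = ±1`). [folklore] -/
theorem abs_le_of_chain {ε₁ p q x : ℝ} (hε₁ : ε₁ = 1 ∨ ε₁ = -1) (h1 : ε₁ * p < ε₁ * x) (h2 : ε₁ * x < ε₁ * q) :
    |x| ≤ |p| + |q| := by
  rw [abs_le]
  rcases hε₁ with rfl | rfl <;> constructor <;>
    linarith [neg_abs_le p, le_abs_self p, neg_abs_le q, le_abs_self q]

/-- The Jacobian algebra of the blow-up: `(b/(εZ)) · (b/(εaZ)) · Z²/(σb)³ = σ/(b a)` for signs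
`ε, σ = ±1`. [folklore] -/
theorem jac_algebra {ε σ a b Z : ℝ} (hε : ε = 1 ∨ ε = -1) (hσ : σ = 1 ∨ σ = -1) (hb : b ≠ 0) (hZ : Z ≠ 0) :
    1 / (ε * Z / b) * (1 / (ε * a * Z / b)) * (Z ^ 2 / (σ * b) ^ 3) = σ / (b * a) := by
  rcases eq_or_ne a 0 with rfl | ha
  · simp
  rcases hε with rfl | rfl <;> rcases hσ with rfl | rfl
  all_goals field_simp

/-- The outer letter after the blow-up: `1/(t₀ + εZ − μ) = ε/(Z − ε (μ − t₀))` (`ε = ±1`). [folklore] -/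
theorem letter_algebra {ε t₀ μ Z : ℝ} (hε : ε = 1 ∨ ε = -1) :
    1 / (t₀ + ε * Z - μ) = ε * (1 / (Z - ε * (μ - t₀))) := by
  rcases hε with rfl | rfl
  · ring
  · have : t₀ + -1 * Z - μ = -(Z - -1 * (μ - t₀)) := by ring
    rw [this, one_div_neg_eq_neg_one_div]
    ring

/-- The absolute Jacobian of the blow-up on the side `σ b > 0`: `Z²/(σ b)³`. [folklore] -/
theorem abs_jac {ε σ b Z : ℝ} (hε : ε = 1 ∨ ε = -1) (hσ : σ = 1 ∨ σ = -1) (hσb : 0 < σ * b) :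
    |-(ε ^ 3 * Z ^ 2 / b ^ 3)| = Z ^ 2 / (σ * b) ^ 3 := by
  have hb : |b| = σ * b := by
    rcases hσ with rfl | rfl
    · rw [one_mul] at hσb ⊢
      exact abs_of_pos hσb
    · rw [abs_of_neg (by linarith)]
      ring
  have hε1 : |ε| = 1 := by rcases hε with rfl | rfl <;> simp
  rw [abs_neg, abs_div, abs_mul, abs_pow, abs_pow, abs_pow, hb, hε1, sq_abs]
  ring

end Algebra

section BlowNest

variable {m m' : ℕ} {i j : Fin 2} (s : KZ.IntegralRep (0 + 1 + 2))
  (M : Fin m' → (Fin (0 + 1) → ℚ) × ℚ) (L : Fin m → (Fin 0 → ℚ) × ℚ) (e : Fin m → ℕ)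
  (p : MvPolynomial (Fin 0) ℚ) (ℓ₁ ℓ₂ : (Fin 0 → ℚ) × ℚ) (a : Fin 2 → Option ((Fin (0 + 1) → ℚ) × ℚ))
  (lo hi : Fin 2 → Fin 2 ⊕ ((Fin (0 + 1) → ℚ) × ℚ)) {n₁ n₂ : ℕ} (h1 : n₁ = 0) (hn : n₂ = 1)
  (hdom : s.domain = gDom 0 2 m' M lo hi) (hint : EqOn s.integrand (glit 0 2 p L e ℓ₁ ℓ₂ n₁ n₂ a) s.domain)
  (hij : i ≠ j) (A Bd : (Fin (0 + 1) → ℚ) × ℚ)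
  (hloi : lo i = Sum.inr A) (hhii : hi i = Sum.inl j) (hloj : lo j = Sum.inl i) (hhij : hi j = Sum.inr Bd)
  (y₀ t₀ α β δ ε₁ σ : ℚ) (hε₁ : ε₁ = 1 ∨ ε₁ = -1) (hσ : σ = 1 ∨ σ = -1) (hδ : 0 < δ)
  (hα : 0 ≤ σ * α) (hβ : 0 ≤ σ * β)
  (hM : ∀ z : Fin (0 + 1 + 2) → ℝ, (∀ r, 0 < affF 0 2 (M r) z) ↔
    (0 < (ε₁ : ℝ) * (z (Fin.castAdd 2 (Fin.last 0)) - y₀) ∧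
      (ε₁ : ℝ) * (z (Fin.castAdd 2 (Fin.last 0)) - y₀) < δ))
  (hA : ∀ z : Fin (0 + 1 + 2) → ℝ, affF 0 2 A z = t₀ + α * (z (Fin.castAdd 2 (Fin.last 0)) - y₀))
  (hB : ∀ z : Fin (0 + 1 + 2) → ℝ, affF 0 2 Bd z = t₀ + β * (z (Fin.castAdd 2 (Fin.last 0)) - y₀))
  (hℓ₂ : ℓ₂.2 = y₀) (hai : a i = some ((fun _ => 0), t₀)) (haj : ∀ c, a j = some c → c.1 (Fin.last 0) = 0)

/-- The rows of the blown-up cell: `ε₁ α < ε₁ b < ε₁ β`. -/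
def buRows (ε₁ α β : ℚ) : Fin 2 → (Fin (0 + 1) → ℚ) × ℚ :=
  ![((fun _ => ε₁), -(ε₁ * α)), ((fun _ => -ε₁), ε₁ * β)]

/-- The lower affine bounds of the blown-up cell: polar fibre `i` above `α` (resp. `b`), radial
fibre `j` above `0`. -/
def buLo (j : Fin 2) (ε₁ α : ℚ) : Fin 2 → (Fin (0 + 1) → ℚ) × ℚ := fun l =>
  if l = j then ((fun _ => 0), 0) else if ε₁ = 1 then ((fun _ => 0), α) else ((fun _ => 1), 0)

/-- The upper affine bounds of the blown-up cell: polar fibre `i` below `b` (resp. `α`), radial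
fibre `j` below `δ σ b`. -/
def buHi (j : Fin 2) (ε₁ α δ σ : ℚ) : Fin 2 → (Fin (0 + 1) → ℚ) × ℚ := fun l =>
  if l = j then ((fun _ => δ * σ), 0) else if ε₁ = 1 then ((fun _ => 1), 0) else ((fun _ => 0), α)

/-- The letters after the blow-up: polar pole `a = 0`, outer letter `μ ↦ ε (μ − t₀)`. -/
def buA (j : Fin 2) (ε t₀ : ℚ) (a : Fin 2 → Option ((Fin (0 + 1) → ℚ) × ℚ)) :
    Fin 2 → Option ((Fin (0 + 1) → ℚ) × ℚ) := fun l =>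
  if l = j then (a j).map (fun c => ((fun _ => 0), ε * (c.2 - t₀))) else some ((fun _ => 0), 0)

/-- The sign absorbed into the numerator: `σ`, times `ε` if the outer fibre is lettered. -/
def buQ (σ ε : ℚ) (aj : Option ((Fin (0 + 1) → ℚ) × ℚ)) : ℚ := σ * aj.elim 1 (fun _ => ε)

include hij hε₁ in
/-- Membership in the blown-up cell, read on the pair `(i, j)`. -/
theorem mem_buDom (w : Fin (0 + 1 + 2) → ℝ) :
    w ∈ gDom 0 2 2 (buRows ε₁ α β) (fun l => Sum.inr (buLo j ε₁ α l)) (fun l => Sum.inr (buHi j ε₁ α δ σ l)) ↔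
      ((ε₁ : ℝ) * α < ε₁ * w 0 ∧ (ε₁ : ℝ) * w 0 < ε₁ * β) ∧
      ((ε₁ : ℝ) * α < ε₁ * w (Fin.natAdd (0 + 1) i) ∧ (ε₁ : ℝ) * w (Fin.natAdd (0 + 1) i) < ε₁ * w 0) ∧
      (0 < w (Fin.natAdd (0 + 1) j) ∧ w (Fin.natAdd (0 + 1) j) < δ * σ * w 0) := by
  rw [mem_gDom_pair hij]
  simp only [pv_inr, buLo, buHi, if_neg hij, if_true, Fin.forall_fin_two, buRows,
    Matrix.cons_val_zero, Matrix.cons_val_one, affF_slope, Rat.cast_zero, Rat.cast_mul,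
    Rat.cast_neg, zero_mul, add_zero]
  refine and_congr ⟨fun h => ⟨by linarith [h.1], by linarith [h.2]⟩,
    fun h => ⟨by linarith [h.1], by linarith [h.2]⟩⟩ (and_congr ?_ Iff.rfl)
  split_ifs with h
  · subst h
    simp [affF_slope]
  · obtain rfl : ε₁ = -1 := hε₁.resolve_left h
    simp only [affF_slope, Rat.cast_one, Rat.cast_zero, Rat.cast_neg, one_mul, zero_mul, add_zero, zero_add,
      neg_mul, neg_lt_neg_iff]
    exact and_comm

include h1 hn hdom hint hij hloi hhii hloj hhij hε₁ hσ hδ hα hβ hM hA hB hℓ₂ hai haj in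
/-- **The pinch-vertex blow-up, polar fibre = inner fibre** (rule 2, pull-back form): the chart
`bmap (σ ε₁) y₀ t₀ j` pulls the nested representation back to the literal product datum
`[rows ε₁ α < ε₁ b < ε₁ β; a between α and b; 0 < Z < δ σ b]` with integrand
`± c/(b · a · (Z − μ'))`. [Kontsevich–Zagier 2001, §1.2, rule (2)] -/
theorem blowNest_pull :
    ∃ r' : KZ.IntegralRep (0 + 1 + 2), Bornology.IsBounded r'.domain ∧
      r'.domain = gDom 0 2 2 (buRows ε₁ α β) (fun l => Sum.inr (buLo j ε₁ α l))
        (fun l => Sum.inr (buHi j ε₁ α δ σ l)) ∧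
      EqOn r'.integrand (glit 0 2 (MvPolynomial.C (buQ σ (σ * ε₁) (a j)) * p) L e ℓ₁ (ℓ₂.1, 0) 0 1
        (buA j (σ * ε₁) t₀ a)) r'.domain ∧
      KZ.of s - KZ.of r' ∈ KZ.relations := by
  subst h1 hn
  -- signs
  have hε₁R : (ε₁ : ℝ) = 1 ∨ (ε₁ : ℝ) = -1 := by rcases hε₁ with rfl | rfl <;> simp
  have hσR : (σ : ℝ) = 1 ∨ (σ : ℝ) = -1 := by rcases hσ with rfl | rfl <;> simp
  have hε2 : (ε₁ : ℝ) * ε₁ = 1 := by rcases hε₁R with h | h <;> rw [h] <;> norm_num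
  set ε : ℚ := σ * ε₁ with hεdef
  have hεσ : (ε : ℝ) = σ * ε₁ := by simp [hεdef]
  have hεR : (ε : ℝ) = 1 ∨ (ε : ℝ) = -1 := by
    rw [hεσ]; rcases hε₁R with h | h <;> rcases hσR with h' | h' <;> rw [h, h'] <;> norm_num
  have hεne : (ε : ℝ) ≠ 0 := by rcases hεR with h | h <;> rw [h] <;> norm_num
  have hδR : (0 : ℝ) < δ := by exact_mod_cast hδ
  have hαR : 0 ≤ (σ : ℝ) * α := by exact_mod_cast hα
  have hβR : 0 ≤ (σ : ℝ) * β := by exact_mod_cast hβ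
  have key : ∀ Z b : ℝ, (ε₁ : ℝ) * (ε * Z / b) = Z / (σ * b) := fun Z b => by
    rw [hεσ]; rcases hε₁R with h | h <;> rcases hσR with h' | h' <;> rw [h, h'] <;> ring
  -- the new data and the chart
  set R : Set (Fin (0 + 1 + 2) → ℝ) := gDom 0 2 2 (buRows ε₁ α β) (fun l => Sum.inr (buLo j ε₁ α l))
    (fun l => Sum.inr (buHi j ε₁ α δ σ l)) with hR
  set f' := glit 0 2 (MvPolynomial.C (buQ σ ε (a j)) * p) L e ℓ₁ (ℓ₂.1, 0) 0 1 (buA j ε t₀ a) with hf'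
  set Ψ : (Fin (0 + 1 + 2) → ℝ) → (Fin (0 + 1 + 2) → ℝ) := bmap (ε : ℝ) (y₀ : ℝ) (t₀ : ℝ) j with hΨ
  have hΨ0 : ∀ w, Ψ w 0 = y₀ + ε * w (Fin.natAdd (0 + 1) j) / w 0 := fun w => bmap_base _ _ _ j w
  have hΨj : ∀ w, Ψ w (Fin.natAdd (0 + 1) j) = t₀ + ε * w (Fin.natAdd (0 + 1) j) := fun w =>
    bmap_rad _ _ _ j w
  have hΨi : ∀ w, Ψ w (Fin.natAdd (0 + 1) i) =
      t₀ + ε * w (Fin.natAdd (0 + 1) i) * w (Fin.natAdd (0 + 1) j) / w 0 := fun w => bmap_pol _ _ _ hij w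
  -- membership in the old domain
  have memD : ∀ z, z ∈ s.domain ↔ (0 < (ε₁ : ℝ) * (z 0 - y₀) ∧ (ε₁ : ℝ) * (z 0 - y₀) < δ) ∧
      ((t₀ : ℝ) + α * (z 0 - y₀) < z (Fin.natAdd (0 + 1) i) ∧
        z (Fin.natAdd (0 + 1) i) < z (Fin.natAdd (0 + 1) j)) ∧
      (z (Fin.natAdd (0 + 1) i) < z (Fin.natAdd (0 + 1) j) ∧
        z (Fin.natAdd (0 + 1) j) < t₀ + β * (z 0 - y₀)) := fun z => by
    rw [hdom, mem_nest M lo hi hij A Bd hloi hhii hloj hhij, hM, hA, hB]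
    exact Iff.rfl
  -- (→) the chart maps the new cell into the old domain
  have to_dom : ∀ w ∈ R, w 0 ≠ 0 ∧ 0 < w (Fin.natAdd (0 + 1) j) ∧ 0 < (σ : ℝ) * w 0 ∧ Ψ w ∈ s.domain := by
    intro w hw
    obtain ⟨⟨hr1, hr2⟩, ⟨hp1, hp2⟩, hZ, hZ'⟩ := (mem_buDom hij α β δ ε₁ σ hε₁ w).1 hw
    have hσb : 0 < (σ : ℝ) * w 0 := by
      have : 0 < (δ : ℝ) * (σ * w 0) := by rw [← mul_assoc]; exact hZ.trans hZ'
      exact (mul_pos_iff_of_pos_left hδR).1 this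
    have hb : w 0 ≠ 0 := fun h => by rw [h, mul_zero] at hσb; exact lt_irrefl _ hσb
    refine ⟨hb, hZ, hσb, ?_⟩
    have hy1 : 0 < (ε₁ : ℝ) * (ε * w (Fin.natAdd (0 + 1) j) / w 0) := by
      rw [key]; exact div_pos hZ hσb
    have hy2 : (ε₁ : ℝ) * (ε * w (Fin.natAdd (0 + 1) j) / w 0) < δ := by
      rw [key, div_lt_iff₀ hσb]; linarith
    have e0 : Ψ w 0 - y₀ = ε * w (Fin.natAdd (0 + 1) j) / w 0 := by rw [hΨ0]; ring
    have ei : Ψ w (Fin.natAdd (0 + 1) i) =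
        t₀ + w (Fin.natAdd (0 + 1) i) * (ε * w (Fin.natAdd (0 + 1) j) / w 0) := by rw [hΨi]; ring
    have ej : Ψ w (Fin.natAdd (0 + 1) j) = t₀ + w 0 * (ε * w (Fin.natAdd (0 + 1) j) / w 0) := by
      rw [hΨj]; field_simp
    rw [memD, e0, ei, ej]
    refine ⟨⟨hy1, hy2⟩, ⟨?_, ?_⟩, ?_, ?_⟩
    · linarith [(slope_iff hε2 hy1).2 hp1]
    · linarith [(slope_iff hε2 hy1).2 hp2]
    · linarith [(slope_iff hε2 hy1).2 hp2]
    · linarith [(slope_iff hε2 hy1).2 hr2]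
  -- (←) the inverse chart maps the old domain into the new cell
  set Φ : (Fin (0 + 1 + 2) → ℝ) → (Fin (0 + 1 + 2) → ℝ) := fun z =>
    Function.update (Function.update (fun _ => (z (Fin.natAdd (0 + 1) j) - t₀) / (z 0 - y₀))
      (Fin.natAdd (0 + 1) i) ((z (Fin.natAdd (0 + 1) i) - t₀) / (z 0 - y₀)))
      (Fin.natAdd (0 + 1) j) (ε * (z (Fin.natAdd (0 + 1) j) - t₀)) with hΦ
  have hij' : (Fin.natAdd (0 + 1) i : Fin (0 + 1 + 2)) ≠ Fin.natAdd (0 + 1) j := fun h =>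
    hij (RebaseZero.tIdx_injective h)
  have h0i : (0 : Fin (0 + 1 + 2)) ≠ Fin.natAdd (0 + 1) i := RebaseZero.yIdx_ne_tIdx i
  have h0j : (0 : Fin (0 + 1 + 2)) ≠ Fin.natAdd (0 + 1) j := RebaseZero.yIdx_ne_tIdx j
  have hΦ0 : ∀ z, Φ z 0 = (z (Fin.natAdd (0 + 1) j) - t₀) / (z 0 - y₀) := fun z => by
    simp only [hΦ, Function.update_of_ne h0j, Function.update_of_ne h0i]
  have hΦi : ∀ z, Φ z (Fin.natAdd (0 + 1) i) = (z (Fin.natAdd (0 + 1) i) - t₀) / (z 0 - y₀) := fun z => by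
    simp only [hΦ, Function.update_of_ne hij', Function.update_self]
  have hΦj : ∀ z, Φ z (Fin.natAdd (0 + 1) j) = ε * (z (Fin.natAdd (0 + 1) j) - t₀) := fun z => by
    simp only [hΦ, Function.update_self]
  have from_dom : ∀ z ∈ s.domain, Φ z ∈ R ∧ Ψ (Φ z) = z := by
    intro z hz
    obtain ⟨⟨hc1, hc2⟩, ⟨hAi, hilt⟩, -, hjB⟩ := (memD z).1 hz
    have hy0 : z 0 - (y₀ : ℝ) ≠ 0 := by rintro h; rw [h, mul_zero] at hc1; exact lt_irrefl _ hc1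
    have eiz : z (Fin.natAdd (0 + 1) i) = t₀ + (z (Fin.natAdd (0 + 1) i) - t₀) / (z 0 - y₀) * (z 0 - y₀) := by
      field_simp; ring
    have ejz : z (Fin.natAdd (0 + 1) j) = t₀ + (z (Fin.natAdd (0 + 1) j) - t₀) / (z 0 - y₀) * (z 0 - y₀) := by
      field_simp; ring
    have hq1 : (ε₁ : ℝ) * α < ε₁ * ((z (Fin.natAdd (0 + 1) i) - t₀) / (z 0 - y₀)) :=
      (slope_iff hε2 hc1).1 (by linarith)
    have hq2 : (ε₁ : ℝ) * ((z (Fin.natAdd (0 + 1) i) - t₀) / (z 0 - y₀)) <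
        ε₁ * ((z (Fin.natAdd (0 + 1) j) - t₀) / (z 0 - y₀)) :=
      (slope_iff hε2 hc1).1 (by linarith)
    have hq3 : (ε₁ : ℝ) * ((z (Fin.natAdd (0 + 1) j) - t₀) / (z 0 - y₀)) < ε₁ * β :=
      (slope_iff hε2 hc1).1 (by linarith)
    have hσb : 0 < (σ : ℝ) * ((z (Fin.natAdd (0 + 1) j) - t₀) / (z 0 - y₀)) :=
      pos_of_chain hε₁R hσR hαR hβR (hq1.trans hq2) hq3
    have hTj : z (Fin.natAdd (0 + 1) j) - (t₀ : ℝ) ≠ 0 := by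
      intro h; rw [h, zero_div, mul_zero] at hσb; exact lt_irrefl _ hσb
    have eZ : (ε : ℝ) * (z (Fin.natAdd (0 + 1) j) - t₀) =
        σ * ((z (Fin.natAdd (0 + 1) j) - t₀) / (z 0 - y₀)) * (ε₁ * (z 0 - y₀)) := by
      rw [hεσ]; field_simp
    constructor
    · rw [hR, mem_buDom hij α β δ ε₁ σ hε₁, hΦ0, hΦi, hΦj, eZ]
      refine ⟨⟨hq1.trans hq2, hq3⟩, ⟨hq1, hq2⟩, mul_pos hσb hc1, ?_⟩
      calc _ < σ * ((z (Fin.natAdd (0 + 1) j) - t₀) / (z 0 - y₀)) * δ := mul_lt_mul_of_pos_left hc2 hσb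
        _ = _ := by ring
    · funext l
      rcases RebaseZero.idx_cases l with rfl | ⟨l', rfl⟩
      · show Ψ (Φ z) 0 = z 0
        rw [hΨ0, hΦj, hΦ0]
        rcases hεR with h | h <;> rw [h] <;> field_simp <;> ring
      · rcases fin_two_eq_or hij l' with rfl | rfl
        · show Ψ (Φ z) (Fin.natAdd (0 + 1) l') = z (Fin.natAdd (0 + 1) l')
          rw [hΨi, hΦi, hΦj, hΦ0]
          rcases hεR with h | h <;> rw [h] <;> field_simp <;> ring
        · show Ψ (Φ z) (Fin.natAdd (0 + 1) l') = z (Fin.natAdd (0 + 1) l')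
          rw [hΨj, hΦj]
          rcases hεR with h | h <;> rw [h] <;> ring
  -- the image, injectivity, calculus, semialgebraicity
  have himage : Ψ '' R = s.domain := by
    ext z
    constructor
    · rintro ⟨w, hw, rfl⟩
      exact (to_dom w hw).2.2.2
    · intro hz
      exact ⟨Φ z, (from_dom z hz).1, (from_dom z hz).2⟩
  have hinj : InjOn Ψ R :=
    bmap_injOn (ε : ℝ) y₀ t₀ hεne j fun w hw => ⟨(to_dom w hw).1, (to_dom w hw).2.1.ne'⟩
  have hRsa : IsSemialgebraic ℚ R := isSemialgebraic_gDom _ _ _ _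
  have hΨsa : IsSemialgebraicMapOn ℚ R Ψ := bmap_isSemialgebraicMapOn ε y₀ t₀ j hRsa fun w hw => (to_dom w hw).1
  have hder : ∀ w ∈ R, HasFDerivWithinAt Ψ (bjac (ε : ℝ) j w) R w := fun w hw =>
    (bmap_hasFDerivAt _ _ _ j w (to_dom w hw).1).hasFDerivWithinAt
  have hf'sa : IsSemialgebraicFunOn ℚ R f' := isSemialgebraicFunOn_glit hRsa _ _ _ _ _ _ _ _
  -- the new integrand is the old one after substitution times the Jacobian
  have hp : ∀ x : Fin 0 → ℝ, MvPolynomial.aeval x p = ((p.coeff 0 : ℚ) : ℝ) := fun x => by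
    conv_lhs => rw [MvPolynomial.eq_C_of_isEmpty p]
    rw [MvPolynomial.aeval_C, eq_ratCast]
  have hff' : ∀ w ∈ R, f' w = s.integrand (Ψ w) * |(bjac (ε : ℝ) j w).det| := by
    intro w hw
    obtain ⟨hb, hZ, hσb, hmem⟩ := to_dom w hw
    have hjac := jac_algebra (a := w (Fin.natAdd (0 + 1) i)) hεR hσR hb hZ.ne'
    rw [hint hmem, bjac_det _ j w hb, abs_jac hεR hσR hσb, hf', glit_eq, glit_eq, fib, fib,
      prod_pair hij, prod_pair hij]
    simp only [map_mul, MvPolynomial.aeval_C, eq_ratCast, hp, affB_zero, pow_zero, pow_one, buA, buQ,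
      if_neg hij, if_true, hai, Option.elim_some, castAdd_last_eq, hΨ0, hΨi, hℓ₂,
      Rat.cast_zero, zero_mul, Finset.sum_const_zero, zero_add, sub_zero, add_sub_cancel_left]
    rcases hc : a j with _ | c
    · simp only [Option.map_none, Option.elim_none, mul_one]
      linear_combination (-(((p.coeff 0 : ℚ) : ℝ) / ∏ j', ((L j').2 : ℝ) ^ e j')) * hjac
    · simp only [Option.map_some, Option.elim_some, letter_sum (haj c hc), hΨj,
        Rat.cast_mul, Rat.cast_sub, Rat.cast_zero, zero_mul, Finset.sum_const_zero, zero_add,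
        letter_algebra (t₀ := (t₀ : ℝ)) (μ := (c.2 : ℝ)) (Z := w (Fin.natAdd (0 + 1) j)) hεR]
      linear_combination (-(((p.coeff 0 : ℚ) : ℝ) / ∏ j', ((L j').2 : ℝ) ^ e j') * ε *
        (1 / (w (Fin.natAdd (0 + 1) j) - ε * (c.2 - t₀)))) * hjac
  -- boundedness of the new cell
  have hbdR : Bornology.IsBounded R := by
    refine isBounded_of_forall_abs_le ((2 + δ) * (|(α : ℝ)| + |(β : ℝ)|)) fun w hw l => ?_
    obtain ⟨⟨hr1, hr2⟩, ⟨hp1, hp2⟩, hZ, hZ'⟩ := (mem_buDom hij α β δ ε₁ σ hε₁ w).1 hw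
    have hS : 0 ≤ |(α : ℝ)| + |(β : ℝ)| := by positivity
    have hb : |w 0| ≤ |(α : ℝ)| + |(β : ℝ)| := abs_le_of_chain hε₁R hr1 hr2
    have ha : |w (Fin.natAdd (0 + 1) i)| ≤ 2 * (|(α : ℝ)| + |(β : ℝ)|) := by
      have := abs_le_of_chain hε₁R hp1 hp2
      linarith [abs_nonneg (β : ℝ)]
    have hz : |w (Fin.natAdd (0 + 1) j)| ≤ δ * (|(α : ℝ)| + |(β : ℝ)|) := by
      rw [abs_of_pos hZ]
      have h1 : (σ : ℝ) * w 0 ≤ |w 0| := by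
        rcases hσR with h | h <;> rw [h]
        · rw [one_mul]; exact le_abs_self _
        · rw [neg_one_mul]; exact neg_le_abs _
      nlinarith
    rcases RebaseZero.idx_cases l with rfl | ⟨l', rfl⟩
    · show |w 0| ≤ _
      nlinarith
    · rcases fin_two_eq_or hij l' with rfl | rfl
      · show |w (Fin.natAdd (0 + 1) l')| ≤ _
        nlinarith
      · show |w (Fin.natAdd (0 + 1) l')| ≤ _
        nlinarith
  -- rule (2)
  obtain ⟨r', hr'd, hr'i, hrel⟩ := RebaseZero.cov_pull s hRsa Ψ (fun w => bjac (ε : ℝ) j w) hΨsa hder hinj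
    himage f' hf'sa hff'
  exact ⟨r', hr'd ▸ hbdR, hr'd, fun w _ => by rw [hr'i], hrel⟩

include h1 hn hdom hint hij hloi hhii hloj hhij hε₁ hσ hδ hα hβ hM hA hB hℓ₂ hai haj in
/-- **The pinch-vertex blow-up, polar fibre = inner fibre**: the nested representation is
GOOD — congruent modulo `KZ.relations` to the subgroup generated by the literal class `GG 0 2 2`
(`RebaseZero.Good 2`): blow up (`blowNest_pull`), then shear/rescale the two product fibres
(`RebasePos.good_product`).
[Kontsevich–Zagier 2001, §1.2, rule (2)] -/
theorem blowNest_inner : RebaseZero.Good 2 (KZ.of s) := by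
  obtain ⟨r', hbd', hdom', hint', hrel⟩ := blowNest_pull s M L e p ℓ₁ ℓ₂ a lo hi h1 hn hdom hint hij A Bd
    hloi hhii hloj hhij y₀ t₀ α β δ ε₁ σ hε₁ hσ hδ hα hβ hM hA hB hℓ₂ hai haj
  refine good_of_sub_mem hrel (good_product (buA j (σ * ε₁) t₀ a) (buLo j ε₁ α) (buHi j ε₁ α δ σ) r'
    (buRows ε₁ α β) L e _ ℓ₁ _ _ _ (Or.inl rfl) hbd' hdom' hint' (fun _ => rfl) (fun _ => rfl)
    fun l c hc => ?_)
  by_cases hl : l = j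
  · subst hl
    refine Or.inl ?_
    simp only [buA, if_true] at hc
    rcases h : a l with _ | c₀
    · simp [h] at hc
    · simp only [h, Option.map_some, Option.some.injEq] at hc
      simp [buLo, ← hc]
  · simp only [buA, if_neg hl, Option.some.injEq] at hc
    subst hc
    by_cases h1' : ε₁ = 1
    · exact Or.inl (by simp [buLo, if_neg hl, h1'])
    · exact Or.inr (by simp [buHi, if_neg hl, h1'])

end BlowNest

end RebaseNest

/-- **Registered part of `stub_rebaseSimpleZeroTwo` / `rebaseSimpleZero_nestedBlowUp` (line
`janus-bands`, v6.2): the pinch-vertex blow-up, polar fibre = inner fibre.** A literal `GS 0 2`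
datum with simple base pole AT `y₀` (`n₁ = 0`, `n₂ = 1`, `ℓ₂ = y₀`), nested fibres
`A < tᵢ < tⱼ < B` over the cell `{0 < ε₁ (y − y₀) < δ}` (`hM`) with both bounds through the pinch
vertex `(y₀, t₀)` (`hA`, `hB`, slopes weakly on the side `σ` of `0`), the pole `tᵢ = t₀` on the
inner fibre (`hai`) and a `y`-free (or no) letter on the outer fibre (`haj`) is congruent modulo
`KZ.relations` to the subgroup generated by the literal class `GG 0 2 2`
(`RebaseNest.blowNest_inner`: ONE rational change of variables, then one affine pull-back).
[Kontsevich–Zagier 2001, §1.2, rule (2)] -/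
theorem rebaseSimpleZero_nestedBlowUpInner (m m' n₁ n₂ : ℕ) (s : KZ.IntegralRep (0 + 1 + 2)) (M : Fin m' → (Fin (0 + 1) → ℚ) × ℚ) (L : Fin m → (Fin 0 → ℚ) × ℚ) (e : Fin m → ℕ) (p : MvPolynomial (Fin 0) ℚ) (ℓ₁ ℓ₂ : (Fin 0 → ℚ) × ℚ) (a : Fin 2 → Option ((Fin (0 + 1) → ℚ) × ℚ)) (lo hi : Fin 2 → Fin 2 ⊕ ((Fin (0 + 1) → ℚ) × ℚ)) (h1 : n₁ = 0) (hn : n₂ = 1) (hdom : s.domain = SeparatePos.gDom 0 2 m' M lo hi) (hint : EqOn s.integrand (RebasePos.glit 0 2 p L e ℓ₁ ℓ₂ n₁ n₂ a) s.domain) (i j : Fin 2) (hij : i ≠ j) (A Bd : (Fin (0 + 1) → ℚ) × ℚ) (hloi : lo i = Sum.inr A) (hhii : hi i = Sum.inl j) (hloj : lo j = Sum.inl i) (hhij : hi j = Sum.inr Bd) (y₀ t₀ α β δ ε₁ σ : ℚ) (hε₁ : ε₁ = 1 ∨ ε₁ = -1) (hσ : σ = 1 ∨ σ = -1) (hδ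 : 0 < δ) (hα : 0 ≤ σ * α) (hβ : 0 ≤ σ * β) (hM : ∀ z : Fin (0 + 1 + 2) → ℝ, (∀ r, 0 < SeparatePos.affF 0 2 (M r) z) ↔ (0 < (ε₁ : ℝ) * (z (Fin.castAdd 2 (Fin.last 0)) - y₀) ∧ (ε₁ : ℝ) * (z (Fin.castAdd 2 (Fin.last 0)) - y₀) < δ)) (hA : ∀ z : Fin (0 + 1 + 2) → ℝ, SeparatePos.affF 0 2 A z = t₀ + α * (z (Fin.castAdd 2 (Fin.last 0)) - y₀)) (hB : ∀ z : Fin (0 + 1 + 2) → ℝ, SeparatePos.affF 0 2 Bd z = t₀ + β * (z (Fin.castAdd 2 (Fin.last 0)) - y₀)) (hℓ₂ : ℓ₂.2 = y₀) (hai : a i = some ((fun _ => 0), t₀)) (haj : ∀ c, a j = some c → c.1 (Fin.last 0) = 0) : ∃ c ∈ AddSubgroup.closure (SeparatePos.GGset 0 2 2), KZ.of s - c ∈ KZ.relations :=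
  RebaseNest.blowNest_inner s M L e p ℓ₁ ℓ₂ a lo hi h1 hn hdom hint hij A Bd hloi hhii hloj hhij y₀ t₀ α β δ ε₁ σ
    hε₁ hσ hδ hα hβ hM hA hB hℓ₂ hai haj

end Summit.KontsevichZagierPeriods.ArrangementNormalForm.JanusBands
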